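import Mathlib.Analysis.SpecialFunctions.Sqrt
import Mathlib.Analysis.Calculus.Deriv.Mul
import Mathlib.Analysis.Calculus.Deriv.Comp
import Literature.Geometry.Lorentzian.KerrTortoiseZones
import Literature.Geometry.Lorentzian.TeukolskyRadialFlux
import HarnessLib

/-!
# Handover from Carter's tortoise data to the blown-up horizon chart, and the bounded frequency box
(namespace `Literature.Geometry.Lorentzian.Kerr`.)

Two elementary bricks of the a priori sup bound for the infinity-normalised scalar radial Teukolsky
solution on sub-extremal Kerr across the near-horizon throat (companions of
`CarterThroatCoefficient.lean` / `CarterThroatTransport.lean`, which transport the Euler amplitude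
`‖W‖ + x‖W′‖` of `W = √(x(x+1))·R(r₊ + (r₊ − r₋)x)` down the blown-up chart
`x = (r − r₊)/(r₊ − r₋)`):

* `throat_handover` — at a radius `r = r₊ + (r₊ − r₋)X ≥ 7M`, `X ≥ 1`, the Euler amplitude
  `‖W X‖ + X‖W′ X‖` is at most `(X+1)²(3A/r + 2M(2B + A/r)/r)` as soon as the tortoise data obey
  `√(r² + a²)‖R r‖ ≤ A` and `(Δ/(r² + a²))‖d/dr[√(r² + a²)R](r)‖ ≤ B` (`u = √(r² + a²)R`,
  `u′ = (Δ/(r² + a²)) d/dr[√(r² + a²)R]` in `r*`): product and chain rule,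
  `W′ = (2X+1)/(2√(X(X+1)))·R + √(X(X+1))·(r₊ − r₋)·R′`,
  `√(r² + a²)R′ = d/dr[√(r² + a²)R] − (r/√(r² + a²))R`, `(r² + a²)/Δ ≤ 7/5` on `r ≥ 7M`
  (`Kerr.IsTortoiseRadius.five_div_seven_le_deriv`), `r₊ − r₋ ≤ 2M`;
* `cone_box_constants` — the frequency box of the near-extremal threshold cone: for
  `M/2 ≤ |a| < M`, `m ≠ 0`, an admissible triple with `Λ ≤ Λ₀` and `|ω − mω₊| ≤ |m|/(16M)`, with
  `μ = √(max Λ₀ 2)`: `ω ≠ 0`, `1/(16M) ≤ |ω| ≤ μ/M`, `1 ≤ Λ ≤ μ²`, `|m| ≤ μ`, `|Λ − 2amω| ≤ 2μ²`,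
  the far radius `max(7M, √(12Λ)/|ω|, 1/(Mω²)) ≤ 256Mμ`, and `|K(r₊)| = (r₊² + a²)|ω − mω₊| ≤ Mμ/4`
  (`Kerr.Costa2019.abs_omega_lower_of_cone`).

Everything is proved by elementary calculus / inequalities.

## References
* M. Dafermos, I. Rodnianski, Y. Shlapentokh-Rothman, arXiv:1402.7034, §2.1.2, §8.
  Key `DafermosRodnianskiShlapentokhrothman2014`.
* S. A. Teukolsky, W. H. Press, Astrophys. J. 193 (1974), 443–461, §II (the chart `x`).
-/

noncomputable section

open Set

namespace Literature.Geometry.Lorentzian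

namespace Kerr

/-! ### Handover to the blown-up chart at a far radius -/

-- adapted from Summits/…/PhaseMixingCaptureKappaExplicitWaveDecayTortoiseReduction.lean
/-- `d/ds (s² + a²)^{1/2} = s/(s² + a²)^{1/2}` at a point `y` with `y² + a² > 0`. [folklore] -/
private theorem hasDerivAt_weight {a y : ℝ} (hy : 0 < y ^ 2 + a ^ 2) :
    HasDerivAt (fun s : ℝ ↦ Real.sqrt (s ^ 2 + a ^ 2)) (y / Real.sqrt (y ^ 2 + a ^ 2)) y := by
  have h1 : HasDerivAt (fun s : ℝ ↦ s ^ 2 + a ^ 2) (2 * y) y := by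
    simpa using (hasDerivAt_pow 2 y).add_const (a ^ 2)
  refine (h1.sqrt hy.ne').congr_deriv ?_
  rw [mul_div_mul_left _ _ (two_ne_zero' ℝ)]

-- adapted from Summits/…/PhaseMixingCaptureKappaExplicitWaveDecayOlverNormalForm.lean
/-- `d/dy √(y(y+1)) = (2y + 1)/(2√(y(y+1)))` at every `y > 0`. [folklore] -/
private theorem hasDerivAt_liouvilleWeight {y : ℝ} (hy : 0 < y) :
    HasDerivAt (fun y : ℝ ↦ √(y * (y + 1))) ((2 * y + 1) / (2 * √(y * (y + 1)))) y := by
  have hP : HasDerivAt (fun y : ℝ ↦ y * (y + 1)) (2 * y + 1) y :=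
    ((hasDerivAt_id' y).fun_mul ((hasDerivAt_id' y).add_const 1)).congr_deriv (by ring)
  exact hP.sqrt (by positivity)

set_option maxHeartbeats 400000 in
/-- **Handover to the blown-up chart.** Let `|a| < M`, `0 < M`, `d = r₊ − r₋`, `1 ≤ X`,
`r = r₊ + dX ≥ 7M`, `R` differentiable at `r` with derivative `R₁`, and let `W₁` be the derivative at
`X` of `W(y) = √(y(y+1))·R(r₊ + d y)`. If `√(r² + a²)‖R r‖ ≤ A` and
`(Δ/(r² + a²))‖d/dr[√(r² + a²)R](r)‖ ≤ B`, then
`‖W X‖ + X‖W₁‖ ≤ (X + 1)²·(3A/r + 2M(2B + A/r)/r)`: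
`W₁ = (2X+1)/(2√(X(X+1)))·R r + √(X(X+1))·d·R₁`, `√(r² + a²)R₁ = d/dr[√(r² + a²)R] − (r/√(r² + a²))R`,
`(r² + a²)/Δ ≤ 7/5` (`IsTortoiseRadius.five_div_seven_le_deriv`), `d ≤ 2M`, `√(r² + a²) ≥ r`. [folklore] -/
theorem throat_handover {M a : ℝ} (hM : 0 < M) (ha : |a| < M) {R : ℝ → ℂ} {R₁ W₁ : ℂ}
    {X r d A B : ℝ} (hd : d = rPlus M a - rMinus M a) (hX : 1 ≤ X)
    (hrX : r = rPlus M a + d * X) (h7 : 7 * M ≤ r) (hRd : HasDerivAt R R₁ r)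
    (hW : HasDerivAt (fun y : ℝ ↦ ((Real.sqrt (y * (y + 1)) : ℝ) : ℂ) * R (rPlus M a + d * y))
      W₁ X)
    (hA : Real.sqrt (r ^ 2 + a ^ 2) * ‖R r‖ ≤ A)
    (hB : delta M a r / (r ^ 2 + a ^ 2) *
      ‖deriv (fun s : ℝ ↦ ((Real.sqrt (s ^ 2 + a ^ 2) : ℝ) : ℂ) * R s) r‖ ≤ B) :
    ‖((Real.sqrt (X * (X + 1)) : ℝ) : ℂ) * R r‖ + X * ‖W₁‖ ≤
      (X + 1) ^ 2 * (3 * A / r + 2 * M * (2 * B + A / r) / r) := by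
  have hsub : IsSubextremal M a := ha
  have hX0 : 0 < X := one_pos.trans_le hX
  have hr0 : 0 < r := by linarith
  have hS2 : 0 < r ^ 2 + a ^ 2 := by positivity
  have hS : 0 < Real.sqrt (r ^ 2 + a ^ 2) := Real.sqrt_pos.2 hS2
  have hSr : r ≤ Real.sqrt (r ^ 2 + a ^ 2) := by
    rw [Real.le_sqrt hr0.le hS2.le]; nlinarith
  have hd0 : 0 < d := by rw [hd]; exact sub_pos.2 hsub.rMinus_lt_rPlus
  have hd2 : d ≤ 2 * M := by
    rw [hd, rPlus_sub_rMinus]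
    have : √(M ^ 2 - a ^ 2) ≤ M := by
      rw [Real.sqrt_le_left hM.le]; nlinarith [sq_nonneg a]
    linarith
  have hA0 : 0 ≤ A := le_trans (by positivity) hA
  have hΔ : 0 < delta M a r / (r ^ 2 + a ^ 2) :=
    lt_of_lt_of_le (by norm_num) (IsTortoiseRadius.five_div_seven_le_deriv hsub h7)
  have hB0 : 0 ≤ B := le_trans (by positivity) hB
  -- `‖R r‖ ≤ A / r`
  have hRr : ‖R r‖ ≤ A / r := by
    rw [le_div_iff₀ hr0]
    calc ‖R r‖ * r ≤ ‖R r‖ * Real.sqrt (r ^ 2 + a ^ 2) := mul_le_mul_of_nonneg_left hSr (norm_nonneg _)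
      _ = Real.sqrt (r ^ 2 + a ^ 2) * ‖R r‖ := mul_comm _ _
      _ ≤ A := hA
  -- the `r`-derivative of `√(r² + a²) R`
  have hD : deriv (fun s : ℝ ↦ ((Real.sqrt (s ^ 2 + a ^ 2) : ℝ) : ℂ) * R s) r =
      ((r / Real.sqrt (r ^ 2 + a ^ 2) : ℝ) : ℂ) * R r + ((Real.sqrt (r ^ 2 + a ^ 2) : ℝ) : ℂ) * R₁ :=
    ((hasDerivAt_weight hS2).ofReal_comp.fun_mul hRd).deriv
  have hnormD : ‖deriv (fun s : ℝ ↦ ((Real.sqrt (s ^ 2 + a ^ 2) : ℝ) : ℂ) * R s) r‖ ≤ 7 / 5 * B := by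
    have h57 := IsTortoiseRadius.five_div_seven_le_deriv hsub h7
    have h1 : 5 / 7 * ‖deriv (fun s : ℝ ↦ ((Real.sqrt (s ^ 2 + a ^ 2) : ℝ) : ℂ) * R s) r‖ ≤ B :=
      (mul_le_mul_of_nonneg_right h57 (norm_nonneg _)).trans hB
    linarith
  have hSR₁ : Real.sqrt (r ^ 2 + a ^ 2) * ‖R₁‖ ≤ 7 / 5 * B + A / r := by
    have e : ((Real.sqrt (r ^ 2 + a ^ 2) : ℝ) : ℂ) * R₁ =
        deriv (fun s : ℝ ↦ ((Real.sqrt (s ^ 2 + a ^ 2) : ℝ) : ℂ) * R s) r -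
        ((r / Real.sqrt (r ^ 2 + a ^ 2) : ℝ) : ℂ) * R r := by rw [hD]; ring
    have h1 : ‖((r / Real.sqrt (r ^ 2 + a ^ 2) : ℝ) : ℂ) * R r‖ ≤ ‖R r‖ := by
      rw [norm_mul, Complex.norm_of_nonneg (by positivity)]
      exact mul_le_of_le_one_left (norm_nonneg _) ((div_le_one hS).2 hSr)
    calc Real.sqrt (r ^ 2 + a ^ 2) * ‖R₁‖ = ‖((Real.sqrt (r ^ 2 + a ^ 2) : ℝ) : ℂ) * R₁‖ := by
          rw [norm_mul, Complex.norm_of_nonneg hS.le]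
      _ ≤ ‖deriv (fun s : ℝ ↦ ((Real.sqrt (s ^ 2 + a ^ 2) : ℝ) : ℂ) * R s) r‖ +
            ‖((r / Real.sqrt (r ^ 2 + a ^ 2) : ℝ) : ℂ) * R r‖ := by rw [e]; exact norm_sub_le _ _
      _ ≤ 7 / 5 * B + A / r := add_le_add hnormD (h1.trans hRr)
  have hR₁ : ‖R₁‖ ≤ (7 / 5 * B + A / r) / r := by
    rw [le_div_iff₀ hr0]
    calc ‖R₁‖ * r ≤ ‖R₁‖ * Real.sqrt (r ^ 2 + a ^ 2) := mul_le_mul_of_nonneg_left hSr (norm_nonneg _)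
      _ = Real.sqrt (r ^ 2 + a ^ 2) * ‖R₁‖ := mul_comm _ _
      _ ≤ 7 / 5 * B + A / r := hSR₁
  -- the value of `W₁`
  have hρ0 : 0 < Real.sqrt (X * (X + 1)) := Real.sqrt_pos.2 (by positivity)
  have hρX : Real.sqrt (X * (X + 1)) ≤ X + 1 := by
    rw [Real.sqrt_le_left (by linarith)]; nlinarith
  have hW₁ : W₁ = (((2 * X + 1) / (2 * Real.sqrt (X * (X + 1))) : ℝ) : ℂ) * R r +
      ((Real.sqrt (X * (X + 1)) : ℝ) : ℂ) * ((d : ℂ) * R₁) := by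
    have hθ : HasDerivAt (fun y : ℝ ↦ rPlus M a + d * y) d X := by
      simpa using ((hasDerivAt_id' X).const_mul d).const_add (rPlus M a)
    have hRd' : HasDerivAt R R₁ (rPlus M a + d * X) := by rw [← hrX]; exact hRd
    have h1 : HasDerivAt (fun y ↦ R (rPlus M a + d * y)) ((d : ℂ) * R₁) X := by
      simpa [Function.comp_def, Complex.real_smul] using hRd'.scomp X hθ
    have h2 := ((hasDerivAt_liouvilleWeight hX0).ofReal_comp).fun_mul h1
    have h3 := hW.unique h2
    rw [h3, ← hrX]
  -- norm of `W₁`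
  have hcoef : (2 * X + 1) / (2 * Real.sqrt (X * (X + 1))) ≤ 3 / 2 := by
    have hρX' : X ≤ Real.sqrt (X * (X + 1)) := by
      rw [Real.le_sqrt hX0.le (by positivity)]; nlinarith
    rw [div_le_div_iff₀ (by positivity) (by norm_num)]
    nlinarith
  have hW₁n : ‖W₁‖ ≤ 3 / 2 * (A / r) + (X + 1) * (2 * M) * ((7 / 5 * B + A / r) / r) := by
    rw [hW₁]
    have h1 : ‖(((2 * X + 1) / (2 * Real.sqrt (X * (X + 1))) : ℝ) : ℂ) * R r‖ ≤ 3 / 2 * (A / r) := by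
      rw [norm_mul, Complex.norm_of_nonneg (by positivity)]
      exact mul_le_mul hcoef hRr (norm_nonneg _) (by norm_num)
    have h2 : ‖((Real.sqrt (X * (X + 1)) : ℝ) : ℂ) * ((d : ℂ) * R₁)‖ ≤
        (X + 1) * (2 * M) * ((7 / 5 * B + A / r) / r) := by
      rw [norm_mul, norm_mul, Complex.norm_of_nonneg hρ0.le, Complex.norm_of_nonneg hd0.le,
        ← mul_assoc]
      exact mul_le_mul (mul_le_mul hρX hd2 hd0.le (by linarith)) hR₁ (norm_nonneg _)
        (by positivity)
    exact (norm_add_le _ _).trans (add_le_add h1 h2)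
  -- norm of `W X`
  have hWn : ‖((Real.sqrt (X * (X + 1)) : ℝ) : ℂ) * R r‖ ≤ (X + 1) * (A / r) := by
    rw [norm_mul, Complex.norm_of_nonneg hρ0.le]
    exact mul_le_mul hρX hRr (norm_nonneg _) (by linarith)
  -- assemble: everything against `(X + 1)²`
  have hAr : 0 ≤ A / r := by positivity
  have hq : 0 ≤ (7 / 5 * B + A / r) / r := by positivity
  have hq' : (7 / 5 * B + A / r) / r ≤ (2 * B + A / r) / r :=
    div_le_div_of_nonneg_right (by linarith) hr0.le
  have hX1sq : X + 1 ≤ (X + 1) ^ 2 := by nlinarith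
  have hXsq : X ≤ (X + 1) ^ 2 := by nlinarith
  have hXX : X * (X + 1) ≤ (X + 1) ^ 2 := by nlinarith
  have hMq : 0 ≤ 2 * M * ((7 / 5 * B + A / r) / r) := by positivity
  calc ‖((Real.sqrt (X * (X + 1)) : ℝ) : ℂ) * R r‖ + X * ‖W₁‖
      ≤ (X + 1) * (A / r) + X * (3 / 2 * (A / r) + (X + 1) * (2 * M) * ((7 / 5 * B + A / r) / r)) :=
        add_le_add hWn (mul_le_mul_of_nonneg_left hW₁n hX0.le)
    _ = (X + 1) * (A / r) + X * (3 / 2 * (A / r)) +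
          X * (X + 1) * (2 * M * ((7 / 5 * B + A / r) / r)) := by ring
    _ ≤ (X + 1) ^ 2 * (A / r) + (X + 1) ^ 2 * (3 / 2 * (A / r)) +
          (X + 1) ^ 2 * (2 * M * ((7 / 5 * B + A / r) / r)) := by
        gcongr
    _ = (X + 1) ^ 2 * (5 / 2 * (A / r) + 2 * M * ((7 / 5 * B + A / r) / r)) := by ring
    _ ≤ (X + 1) ^ 2 * (3 * (A / r) + 2 * M * ((2 * B + A / r) / r)) := by
        gcongr (X + 1) ^ 2 * (?_ + 2 * M * ?_)
        linarith
    _ = (X + 1) ^ 2 * (3 * A / r + 2 * M * (2 * B + A / r) / r) := by ring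

/-! ### The frequency box -/

/-- **Constants of the bounded box in the cone.** Let `0 < M`, `μ = √(max Λ₀ 2)`, `M/2 ≤ |a| < M`,
`(ω, m, Λ)` admissible with `m ≠ 0`, `Λ ≤ Λ₀`, and `|ω − mω₊| ≤ |m|/(16M)`. Then `ω ≠ 0`,
`1/(16M) ≤ |ω| ≤ μ/M`, `1 ≤ Λ ≤ μ²`, `|m| ≤ μ`, `|Λ − 2amω| ≤ 2μ²`,
`max(7M, √(12Λ)/|ω|, 1/(Mω²)) ≤ 256Mμ`, and `|K(r₊)| = |ω(r₊² + a²) − am| ≤ Mμ/4`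
(`Costa2019.abs_omega_lower_of_cone`, `|ω₊| ≤ 1/(2M)`, `r₊² + a² = 2Mr₊ ≤ 4M²`). [folklore] -/
theorem cone_box_constants {M Λ₀ a ω Λ : ℝ} {m : ℤ} (hM : 0 < M) (ha₁ : M / 2 ≤ |a|) (ha : |a| < M)
    (hadm : IsAdmissibleTriple a ω m Λ) (hm : m ≠ 0) (hΛ : Λ ≤ Λ₀)
    (hcone : |ω - m * horizonAngularVelocity M a| ≤ 1 / (16 * M) * |(m : ℝ)|) :
    ω ≠ 0 ∧ 1 / (16 * M) ≤ |ω| ∧ |ω| ≤ Real.sqrt (max Λ₀ 2) / M ∧ 1 ≤ Λ ∧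
      Λ ≤ Real.sqrt (max Λ₀ 2) ^ 2 ∧ |(m : ℝ)| ≤ Real.sqrt (max Λ₀ 2) ∧
      |Λ - 2 * a * m * ω| ≤ 2 * Real.sqrt (max Λ₀ 2) ^ 2 ∧
      max (7 * M) (max (Real.sqrt (12 * Λ) / |ω|) (1 / (M * ω ^ 2))) ≤
        256 * M * Real.sqrt (max Λ₀ 2) ∧
      |radialK a ω m (rPlus M a)| ≤ M * Real.sqrt (max Λ₀ 2) / 4 := by
  set μ := Real.sqrt (max Λ₀ 2) with hμ_def
  have hμ2 : μ ^ 2 = max Λ₀ 2 := Real.sq_sqrt (le_max_of_le_right zero_le_two)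
  have hμ1 : 1 ≤ μ := by
    rw [hμ_def, Real.le_sqrt zero_le_one (le_max_of_le_right zero_le_two), one_pow]
    exact le_max_of_le_right (by norm_num)
  have hμ0 : 0 < μ := one_pos.trans_le hμ1
  have hm1 : (1 : ℝ) ≤ |(m : ℝ)| := by exact_mod_cast Int.one_le_abs hm
  -- `Λ`
  have hΛ1 : 1 ≤ Λ := by
    have h := hadm.1
    nlinarith [abs_nonneg (m : ℝ)]
  have hΛμ : Λ ≤ μ ^ 2 := by rw [hμ2]; exact hΛ.trans (le_max_left _ _)
  have hmμ : |(m : ℝ)| ≤ μ := by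
    rw [hμ_def]
    exact Real.abs_le_sqrt ((hadm.sq_le.trans hΛ).trans (le_max_left _ _))
  -- `|ω| ≥ 1/(16M)`
  have hlow := Costa2019.abs_omega_lower_of_cone hM (half_pos hM) ha₁ hcone
  have hω16 : 1 / (16 * M) ≤ |ω| := by
    have e : (M / 2 / (4 * M ^ 2) - 1 / (16 * M)) = 1 / (16 * M) := by field_simp; ring
    rw [e] at hlow
    calc 1 / (16 * M) = 1 / (16 * M) * 1 := (mul_one _).symm
      _ ≤ 1 / (16 * M) * |(m : ℝ)| := mul_le_mul_of_nonneg_left hm1 (by positivity)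
      _ ≤ |ω| := hlow
  have hω0 : ω ≠ 0 := abs_pos.1 ((by positivity : (0 : ℝ) < 1 / (16 * M)).trans_le hω16)
  -- `|ω| ≤ μ/M`
  have hrp : 0 < rPlus M a := rPlus_pos hM a
  have hMr : M ≤ rPlus M a := M_le_rPlus M a
  have hΩ : |horizonAngularVelocity M a| ≤ 1 / (2 * M) := by
    rw [horizonAngularVelocity, abs_div, abs_of_pos (by positivity : 0 < 2 * M * rPlus M a),
      div_le_div_iff₀ (by positivity) (by positivity)]
    nlinarith [abs_nonneg a]
  have hωup : |ω| ≤ μ / M := by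
    have h1 : |ω| ≤ |(m : ℝ) * horizonAngularVelocity M a| + |ω - m * horizonAngularVelocity M a| := by
      have := abs_add_le ((m : ℝ) * horizonAngularVelocity M a)
        (ω - m * horizonAngularVelocity M a)
      rwa [add_sub_cancel] at this
    rw [abs_mul] at h1
    have h2 : |(m : ℝ)| * |horizonAngularVelocity M a| ≤ μ * (1 / (2 * M)) :=
      mul_le_mul hmμ hΩ (abs_nonneg _) hμ0.le
    have h3 : 1 / (16 * M) * |(m : ℝ)| ≤ 1 / (16 * M) * μ := mul_le_mul_of_nonneg_left hmμ (by positivity)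
    have h4 : μ * (1 / (2 * M)) + 1 / (16 * M) * μ ≤ μ / M := by
      have e : μ * (1 / (2 * M)) + 1 / (16 * M) * μ = (9 / 16) * (μ / M) := by field_simp; ring
      rw [e]; nlinarith [div_pos hμ0 hM]
    linarith
  -- `|Λ − 2amω| ≤ 2μ²`
  have hL : |Λ - 2 * a * m * ω| ≤ 2 * μ ^ 2 := by
    have h1 : |Λ - 2 * a * m * ω| ≤ |Λ| + |2 * a * m * ω| := abs_sub _ _
    rw [abs_of_pos (one_pos.trans_le hΛ1)] at h1
    have h2 : |2 * a * ↑m * ω| = 2 * |a * m * ω| := by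
      rw [show 2 * a * (m : ℝ) * ω = 2 * (a * m * ω) by ring, abs_mul, abs_two]
    rw [h2] at h1
    linarith [hadm.2]
  -- `R_far ≤ 256 M μ`
  have hR : max (7 * M) (max (Real.sqrt (12 * Λ) / |ω|) (1 / (M * ω ^ 2))) ≤ 256 * M * μ := by
    have hω0' : 0 < |ω| := abs_pos.2 hω0
    refine max_le (by nlinarith) (max_le ?_ ?_)
    · rw [div_le_iff₀ hω0']
      have h1 : Real.sqrt (12 * Λ) ≤ 4 * μ := by
        rw [Real.sqrt_le_left (by positivity)]; nlinarith
      have h2 : 4 * μ ≤ 256 * M * μ * (1 / (16 * M)) := by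
        have e : 256 * M * μ * (1 / (16 * M)) = 16 * μ := by field_simp; ring
        rw [e]; nlinarith
      exact h1.trans (h2.trans (mul_le_mul_of_nonneg_left hω16 (by positivity)))
    · rw [div_le_iff₀ (by positivity)]
      have h1 : (1 / (16 * M)) ^ 2 ≤ ω ^ 2 := by
        rw [← sq_abs ω]; exact pow_le_pow_left₀ (by positivity) hω16 2
      have h2 : (1 : ℝ) = 256 * M * 1 * (M * (1 / (16 * M)) ^ 2) := by field_simp; ring
      calc (1 : ℝ) = 256 * M * 1 * (M * (1 / (16 * M)) ^ 2) := h2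
        _ ≤ 256 * M * μ * (M * ω ^ 2) := by gcongr
  -- `|K(r₊)| ≤ M μ / 4`
  have hK : |radialK a ω m (rPlus M a)| ≤ M * μ / 4 := by
    have hA : rPlus M a ^ 2 + a ^ 2 = 2 * M * rPlus M a := rPlus_sq_add_sq ha.le
    have e : radialK a ω m (rPlus M a) =
        (2 * M * rPlus M a) * (ω - m * horizonAngularVelocity M a) := by
      rw [radialK, hA, horizonAngularVelocity]
      field_simp
    rw [e, abs_mul, abs_of_pos (by positivity : 0 < 2 * M * rPlus M a)]
    have h2M : rPlus M a ≤ 2 * M := rPlus_le_two_mul_self hM.le a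
    calc 2 * M * rPlus M a * |ω - ↑m * horizonAngularVelocity M a|
        ≤ 2 * M * (2 * M) * (1 / (16 * M) * μ) := by
          apply mul_le_mul (by nlinarith) (hcone.trans (mul_le_mul_of_nonneg_left hmμ (by positivity)))
            (abs_nonneg _) (by positivity)
      _ = M * μ / 4 := by field_simp; ring
  exact ⟨hω0, hω16, hωup, hΛ1, hΛμ, hmμ, hL, hR, hK⟩

end Kerr

end Literature.Geometry.Lorentzian

end
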